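import Summits.Ventures.PercRepro.C025ProfilePLDFreePoints

/-!
# THE HYPERPLANE-ADJACENT INSTANCE OF PER-LAYER DOMINANCE ON MATROIDS WITH THIN COLINES (night-3 g32)

`proofs/NIGHT3-G32-MATCHING.md` §1–§2.  The instance `[r−2, r−2, 1; 2r−3]` of (PLD) — the row `(r−2, r−1)` of (Π),
equivalently `(r−1)·N(r−2, r−1) + r·N(r−2, r) ≤ (r−1)·Λ(r−1)` — is the first instance that no refined deletion–contraction
cone model certifies from rank 5 (g31 §3, §6, §10).  It is a `b`-matching statement: every SOURCE `I` (`ρ(I) = r−2`,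
`ρ(E ∖ I) ≥ r−1`) must place `ρ(E ∖ I)` units on the TARGETS `I ∪ {d}`, `d ∉ cl(I)` (rank `r−1`), each target taking at
most `r−1` units — one per coloop of the target, and the coloops of a set of rank `r−1` are independent, so there are at
most `r−1` of them (`card_coloops_le_eRk`).  When every source has at least `ρ(E ∖ I)` directions `d ∉ cl(I)` — THIN
COLINES, e.g. every rank-`(r−2)` flat has at least `r` elements outside it — the injection `(I, d) ↦ (I ∪ {d}, d)` does
the whole job (`sum_le_of_thin`); the census of the matching on every matroid with at most 9 elements, and the
failure of every local weighting on fat colines, are in the paper.  Corollaries: the instance in the hPLD binder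
(`pld_instance_of_thin`), the row `(r−2, r−1)` of (Π) (`profileIneq_of_thin`) and C-025 at `(r, r−2)`
(`rls_of_thin`, `rls_of_thin_flats`) on every matroid with thin colines.  No `def`, no `instance`, no notation.
Axioms: standard.
-/

open scoped Matroid

namespace PercRepro

open Finset ThmH

namespace PLDThin

variable {α : Type} [DecidableEq α]

/-- If `d ∈ S` lies in the closure of `S ∖ {d}` then removing `d` does not change the rank. -/
theorem eRk_erase_eq_of_mem_closure (M : Matroid α) [M.Finite] {S : Finset α} (hS : S ⊆ gr M) {d : α}
    (hd : d ∈ M.closure ((S.erase d : Finset α) : Set α)) :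
    M.eRk ((S.erase d : Finset α) : Set α) = M.eRk (S : Set α) := by
  have hSE : (S : Set α) ⊆ M.E := by rw [← coe_gr M]; exact_mod_cast hS
  apply le_antisymm (M.eRk_mono (by exact_mod_cast Finset.erase_subset d S))
  have hsub : (S : Set α) ⊆ M.closure ((S.erase d : Finset α) : Set α) := by
    intro x hx
    by_cases hxd : x = d
    · subst hxd; exact hd
    · exact M.subset_closure _ (((Finset.coe_subset).2 (Finset.erase_subset d S)).trans hSE)
        (by rw [Finset.mem_coe, Finset.mem_erase]; exact ⟨hxd, by exact_mod_cast hx⟩)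
  calc M.eRk (S : Set α) ≤ M.eRk (M.closure ((S.erase d : Finset α) : Set α)) := M.eRk_mono hsub
    _ = M.eRk ((S.erase d : Finset α) : Set α) := M.eRk_closure_eq _

omit [DecidableEq α] in
/-- The rank of a finite matroid is finite, in `ℕ∞`. -/
theorem eRk_ne_top (M : Matroid α) [M.Finite] (X : Set α) : M.eRk X ≠ ⊤ := PLDClosure.eRk_ne_top' M X

/-- THE COLOOPS OF A SET ARE INDEPENDENT: the elements `d ∈ S` whose removal lowers the rank form an independent set. -/
theorem indep_coloops (M : Matroid α) [M.Finite] {S : Finset α} (hS : S ⊆ gr M) :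
    M.Indep ((S.filter (fun d => (M.eRk ((S.erase d : Finset α) : Set α)).toNat <
      (M.eRk (S : Set α)).toNat) : Finset α) : Set α) := by
  have hSE : (S : Set α) ⊆ M.E := by rw [← coe_gr M]; exact_mod_cast hS
  set D := S.filter (fun d => (M.eRk ((S.erase d : Finset α) : Set α)).toNat < (M.eRk (S : Set α)).toNat) with hD
  have hDS : D ⊆ S := Finset.filter_subset _ _
  have hDE : (D : Set α) ⊆ M.E := (Finset.coe_subset.2 hDS).trans hSE
  rw [Matroid.indep_iff_forall_notMem_closure_sdiff hDE]
  intro d hdD hdcl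
  rw [Finset.mem_coe, hD, Finset.mem_filter] at hdD
  obtain ⟨hdS, hlt⟩ := hdD
  have hsub : ((D : Set α) \ {d}) ⊆ ((S.erase d : Finset α) : Set α) := by
    intro x hx
    rw [Set.mem_sdiff, Set.mem_singleton_iff] at hx
    rw [Finset.mem_coe, Finset.mem_erase]
    exact ⟨hx.2, hDS (by exact_mod_cast hx.1)⟩
  have hd' : d ∈ M.closure ((S.erase d : Finset α) : Set α) := M.closure_subset_closure hsub hdcl
  have := eRk_erase_eq_of_mem_closure M hS hd'
  rw [this] at hlt
  exact lt_irrefl _ hlt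

/-- A SET OF RANK `u` HAS AT MOST `u` COLOOPS. -/
theorem card_coloops_le_eRk (M : Matroid α) [M.Finite] {S : Finset α} (hS : S ⊆ gr M) :
    (S.filter (fun d => (M.eRk ((S.erase d : Finset α) : Set α)).toNat <
      (M.eRk (S : Set α)).toNat)).card ≤ (M.eRk (S : Set α)).toNat := by
  have h := (indep_coloops M hS).encard_le_eRk_of_subset
    (Finset.coe_subset.2 (Finset.filter_subset _ _))
  rw [Set.encard_coe_eq_coe_finsetCard] at h
  have h2 := ENat.toNat_le_toNat h (eRk_ne_top M _)
  simpa using h2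

/-- Adding a point outside the closure raises the rank by exactly one, in `ℕ`. -/
theorem toNat_eRk_insert (M : Matroid α) [M.Finite] (I : Finset α) {d : α} (hd : d ∈ gr M)
    (hdcl : d ∉ M.closure (I : Set α)) :
    (M.eRk ((insert d I : Finset α) : Set α)).toNat = (M.eRk (I : Set α)).toNat + 1 := by
  have hdE : d ∈ M.E := by rw [← coe_gr M]; exact_mod_cast hd
  obtain ⟨n, hn⟩ : ∃ n : ℕ, M.eRk (I : Set α) = n := ⟨_, (ENat.coe_toNat (eRk_ne_top M _)).symm⟩
  rw [Finset.coe_insert, Matroid.eRk_insert_eq_add_one ⟨hdE, hdcl⟩, hn]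
  exact_mod_cast ENat.toNat_coe (n + 1)

open scoped Classical in
/-- THE INJECTION `(I, d) ↦ (I ∪ {d}, d)`: on a matroid whose sources all have at least `ρ(E ∖ I)` directions
`d ∉ cl(I)` (THIN COLINES), `Σ_{ρ(I) = r−2, ρ(E∖I) ≥ r−1} ρ(E ∖ I) ≤ (r−1)·#{S : ρ(S) = r−1}`. -/
theorem sum_le_of_thin (M : Matroid α) [M.Finite] (r : ℕ) (h2 : 2 ≤ r)
    (hthin : ∀ I ∈ (gr M).powerset, (M.eRk (I : Set α)).toNat = r - 2 →
      r - 1 ≤ (M.eRk ((gr M \ I : Finset α) : Set α)).toNat →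
      (M.eRk ((gr M \ I : Finset α) : Set α)).toNat ≤
        ((gr M).filter (fun d => d ∉ M.closure (I : Set α))).card) :
    (∑ I ∈ (gr M).powerset, (if (M.eRk (I : Set α)).toNat = r - 2 ∧
        r - 1 ≤ (M.eRk ((gr M \ I : Finset α) : Set α)).toNat then
        (M.eRk ((gr M \ I : Finset α) : Set α)).toNat else 0)) ≤
      (r - 1) * ((gr M).powerset.filter (fun S : Finset α => (M.eRk (S : Set α)).toNat = r - 1)).card := by
  -- the sources, the directions, the targets and their coloops
  set A := (gr M).powerset.filter (fun I : Finset α => (M.eRk (I : Set α)).toNat = r - 2 ∧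
    r - 1 ≤ (M.eRk ((gr M \ I : Finset α) : Set α)).toNat) with hA
  set out : Finset α → Finset α := fun I => (gr M).filter (fun d => d ∉ M.closure (I : Set α)) with hout
  set B := (gr M).powerset.filter (fun S : Finset α => (M.eRk (S : Set α)).toNat = r - 1) with hB
  set D : Finset α → Finset α := fun S => S.filter (fun d =>
    (M.eRk ((S.erase d : Finset α) : Set α)).toNat < (M.eRk (S : Set α)).toNat) with hD
  -- step 1: the left side is at most the number of pairs (I, d)
  have step1 : (∑ I ∈ (gr M).powerset, (if (M.eRk (I : Set α)).toNat = r - 2 ∧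
      r - 1 ≤ (M.eRk ((gr M \ I : Finset α) : Set α)).toNat then
      (M.eRk ((gr M \ I : Finset α) : Set α)).toNat else 0)) ≤ ∑ I ∈ A, (out I).card := by
    rw [← Finset.sum_filter]
    apply Finset.sum_le_sum
    intro I hI
    have hI' := Finset.mem_filter.1 hI
    exact hthin I hI'.1 hI'.2.1 hI'.2.2
  -- step 2: pairs (I, d) inject into pairs (S, d) with S a target and d a coloop of S
  have step2 : ∑ I ∈ A, (out I).card ≤ ∑ S ∈ B, (D S).card := by
    rw [← Finset.card_sigma]
    have hinj : Set.InjOn (fun p : (Σ _ : Finset α, α) => ((insert p.2 p.1 : Finset α), p.2))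
        ((A.sigma out : Finset (Σ _ : Finset α, α)) : Set (Σ _ : Finset α, α)) := by
      intro p hp q hq hpq
      obtain ⟨I, d⟩ := p
      obtain ⟨I', d'⟩ := q
      simp only [Finset.coe_sigma, Set.mem_sigma_iff, Finset.mem_coe] at hp hq
      simp only [Prod.mk.injEq] at hpq
      obtain ⟨h1, rfl⟩ := hpq
      have hIE : (I : Set α) ⊆ M.E := by
        rw [← coe_gr M]; exact_mod_cast Finset.mem_powerset.1 (Finset.mem_filter.1 hp.1).1
      have hIE' : (I' : Set α) ⊆ M.E := by
        rw [← coe_gr M]; exact_mod_cast Finset.mem_powerset.1 (Finset.mem_filter.1 hq.1).1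
      have hdI : d ∉ I := fun h => (Finset.mem_filter.1 hp.2).2 (M.subset_closure _ hIE (by exact_mod_cast h))
      have hdI' : d ∉ I' := fun h => (Finset.mem_filter.1 hq.2).2 (M.subset_closure _ hIE' (by exact_mod_cast h))
      have : I = I' := by rw [← Finset.erase_insert hdI, h1, Finset.erase_insert hdI']
      subst this
      rfl
    rw [← Finset.card_image_of_injOn hinj]
    refine (Finset.card_le_card ?_).trans ((Finset.card_biUnion_le).trans (Finset.sum_le_sum
      (fun S _ => Finset.card_image_le (f := fun d => (S, d)) (s := D S))))
    intro x hx
    rw [Finset.mem_image] at hx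
    obtain ⟨⟨I, d⟩, hp, rfl⟩ := hx
    rw [Finset.mem_sigma] at hp
    obtain ⟨hIA, hdout⟩ := hp
    rw [hA, Finset.mem_filter, Finset.mem_powerset] at hIA
    rw [hout, Finset.mem_filter] at hdout
    obtain ⟨hI, hIr, _⟩ := hIA
    obtain ⟨hd, hdcl⟩ := hdout
    have hIE : (I : Set α) ⊆ M.E := by rw [← coe_gr M]; exact_mod_cast hI
    have hdI : d ∉ I := fun h => hdcl (M.subset_closure _ hIE (by exact_mod_cast h))
    have hS : (insert d I : Finset α) ⊆ gr M := Finset.insert_subset hd hI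
    have hSr : (M.eRk ((insert d I : Finset α) : Set α)).toNat = r - 1 := by
      rw [toNat_eRk_insert M I hd hdcl, hIr]; omega
    rw [Finset.mem_biUnion]
    refine ⟨insert d I, ?_, ?_⟩
    · rw [hB, Finset.mem_filter, Finset.mem_powerset]; exact ⟨hS, hSr⟩
    · rw [Finset.mem_image]
      refine ⟨d, ?_, rfl⟩
      rw [hD, Finset.mem_filter, Finset.erase_insert hdI, hSr, hIr]
      exact ⟨Finset.mem_insert_self d I, by omega⟩
  -- step 3: a target of rank r−1 has at most r−1 coloops
  have step3 : ∑ S ∈ B, (D S).card ≤ ∑ S ∈ B, (r - 1) := by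
    apply Finset.sum_le_sum
    intro S hS
    rw [hB, Finset.mem_filter, Finset.mem_powerset] at hS
    exact (card_coloops_le_eRk M hS.1).trans (le_of_eq hS.2)
  rw [Finset.sum_const, smul_eq_mul, mul_comm] at step3
  exact step1.trans (step2.trans step3)

omit [DecidableEq α] in
/-- `(ρ X).toNat = u` iff `ρ X = u`, for a finite matroid. -/
theorem toNat_eRk_eq_iff (M : Matroid α) [M.Finite] (X : Set α) (u : ℕ) :
    (M.eRk X).toNat = u ↔ M.eRk X = (u : ℕ∞) := by
  constructor
  · intro h; rw [← ENat.coe_toNat (eRk_ne_top M X), h]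
  · intro h; rw [h, ENat.toNat_coe]

/-- Complementation `I ↦ gr M ∖ I` is a bijection of the powerset: counting a property of the complement. -/
theorem card_filter_compl (M : Matroid α) [M.Finite] (p : Finset α → Prop) [DecidablePred p] :
    ((gr M).powerset.filter (fun I => p (gr M \ I))).card = ((gr M).powerset.filter (fun S => p S)).card := by
  refine Finset.card_nbij' (fun I => gr M \ I) (fun S => gr M \ S) ?_ ?_ ?_ ?_
  · intro I hI
    rw [Finset.mem_coe, Finset.mem_filter, Finset.mem_powerset] at hI ⊢
    exact ⟨Finset.sdiff_subset, hI.2⟩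
  · intro S hS
    rw [Finset.mem_coe, Finset.mem_filter, Finset.mem_powerset] at hS ⊢
    exact ⟨Finset.sdiff_subset, by rw [Finset.sdiff_sdiff_eq_self hS.1]; exact hS.2⟩
  · intro I hI
    rw [Finset.mem_coe, Finset.mem_filter, Finset.mem_powerset] at hI
    exact Finset.sdiff_sdiff_eq_self hI.1
  · intro S hS
    rw [Finset.mem_coe, Finset.mem_filter, Finset.mem_powerset] at hS
    exact Finset.sdiff_sdiff_eq_self hS.1

open scoped Classical in
/-- THE HYPERPLANE-ADJACENT INSTANCE `[r−2, r−2, 1; 2r−3]` OF PER-LAYER DOMINANCE, in the hPLD binder of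
`PLDBridge.rls_disjointSum_freeOn_of_pld`, on every matroid with thin colines. -/
theorem pld_instance_of_thin (M : Matroid α) [M.Finite] (r : ℕ) (h2 : 2 ≤ r)
    (hthin : ∀ I ∈ (gr M).powerset, (M.eRk (I : Set α)).toNat = r - 2 →
      r - 1 ≤ (M.eRk ((gr M \ I : Finset α) : Set α)).toNat →
      (M.eRk ((gr M \ I : Finset α) : Set α)).toNat ≤
        ((gr M).filter (fun d => d ∉ M.closure (I : Set α))).card) :
    (∑ I ∈ (gr M).powerset, (if r - 2 ≤ (M.eRk (I : Set α)).toNat ∧ (M.eRk (I : Set α)).toNat ≤ r - 2 ∧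
        2 * r - 3 ≤ (M.eRk ((gr M \ I : Finset α) : Set α)).toNat + (M.eRk (I : Set α)).toNat then
        ((M.eRk ((gr M \ I : Finset α) : Set α)).toNat).choose 1 else 0)) ≤
      ∑ I ∈ (gr M).powerset, (if r - 2 + 1 ≤ (M.eRk ((gr M \ I : Finset α) : Set α)).toNat ∧
        (M.eRk ((gr M \ I : Finset α) : Set α)).toNat ≤ r - 2 + 1 then
        ((M.eRk ((gr M \ I : Finset α) : Set α)).toNat).choose 1 else 0) := by
  have hL : (∑ I ∈ (gr M).powerset, (if r - 2 ≤ (M.eRk (I : Set α)).toNat ∧ (M.eRk (I : Set α)).toNat ≤ r - 2 ∧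
        2 * r - 3 ≤ (M.eRk ((gr M \ I : Finset α) : Set α)).toNat + (M.eRk (I : Set α)).toNat then
        ((M.eRk ((gr M \ I : Finset α) : Set α)).toNat).choose 1 else 0)) =
      ∑ I ∈ (gr M).powerset, (if (M.eRk (I : Set α)).toNat = r - 2 ∧
        r - 1 ≤ (M.eRk ((gr M \ I : Finset α) : Set α)).toNat then
        (M.eRk ((gr M \ I : Finset α) : Set α)).toNat else 0) := by
    apply Finset.sum_congr rfl
    intro I _
    rw [Nat.choose_one_right]
    split_ifs with ha hb hb <;> first | rfl | (exfalso; omega)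
  have hR : (∑ I ∈ (gr M).powerset, (if r - 2 + 1 ≤ (M.eRk ((gr M \ I : Finset α) : Set α)).toNat ∧
        (M.eRk ((gr M \ I : Finset α) : Set α)).toNat ≤ r - 2 + 1 then
        ((M.eRk ((gr M \ I : Finset α) : Set α)).toNat).choose 1 else 0)) =
      (r - 1) * ((gr M).powerset.filter (fun I : Finset α =>
        (M.eRk ((gr M \ I : Finset α) : Set α)).toNat = r - 1)).card := by
    rw [Finset.card_eq_sum_ones, Finset.sum_filter, Finset.mul_sum]
    apply Finset.sum_congr rfl
    intro I _
    rw [Nat.choose_one_right]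
    split_ifs with ha hb hb
    · omega
    · exfalso; omega
    · exfalso; omega
    · rfl
  have hc := card_filter_compl M (fun S : Finset α => (M.eRk (S : Set α)).toNat = r - 1)
  rw [hL, hR, hc]
  exact sum_le_of_thin M r h2 hthin

open scoped Classical in
/-- The profile price of a rank-`(r−2)` set at level `r−1` is `ρ(E ∖ B) / (r−1)` when `ρ(E ∖ B) ≥ r−1`, else `0`. -/
theorem price_eq (M : Matroid α) [M.Finite] (r : ℕ) (h2 : 2 ≤ r) (B : Finset α) :
    Profile.price M (r - 2) (r - 1) B =
      if r - 1 ≤ (M.eRk ((gr M \ B : Finset α) : Set α)).toNat then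
        (((M.eRk ((gr M \ B : Finset α) : Set α)).toNat : ℕ) : ℚ) / ((r - 1 : ℕ) : ℚ) else 0 := by
  unfold Profile.price
  set n := (M.eRk ((gr M \ B : Finset α) : Set α)).toNat with hn
  have hcond : (((r - 1 : ℕ) : ℕ∞) ≤ M.eRk ((gr M \ B : Finset α) : Set α)) ↔ r - 1 ≤ n := by
    rw [← ENat.coe_toNat (eRk_ne_top M ((gr M \ B : Finset α) : Set α)), ← hn]
    exact Nat.cast_le
  by_cases h : r - 1 ≤ n
  · rw [if_pos (hcond.2 h), if_pos h]
    obtain ⟨q, rfl⟩ : ∃ q, r = q + 2 := ⟨r - 2, by omega⟩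
    have hq1 : q + 2 - 1 = q + 1 := by omega
    have hq2 : q + 2 - 2 = q := by omega
    rw [hq1, hq2]
    have key : ((n + q).choose (q + 1) : ℚ) * ((q + 1 : ℕ) : ℚ) = ((n + q).choose q : ℚ) * (n : ℚ) := by
      have := Nat.choose_succ_right_eq (n + q) q
      rw [Nat.add_sub_cancel] at this
      exact_mod_cast this
    have hC : ((n + q).choose q : ℚ) ≠ 0 := by
      exact_mod_cast (Nat.choose_pos (Nat.le_add_left q n)).ne'
    have hq : ((q + 1 : ℕ) : ℚ) ≠ 0 := by exact_mod_cast Nat.succ_ne_zero q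
    rw [div_eq_div_iff hC hq]
    linarith [key]
  · rw [if_neg (fun h' => h (hcond.1 h')), if_neg h]

omit [DecidableEq α] in
/-- The rank-`u` sets, described by `toNat`. -/
theorem levelSet_eq (M : Matroid α) [M.Finite] (u : ℕ) :
    Shadow.levelSet M u = (gr M).powerset.filter (fun S : Finset α => (M.eRk (S : Set α)).toNat = u) := by
  ext S
  rw [Profile.mem_levelSet, Finset.mem_filter, Finset.mem_powerset, toNat_eRk_eq_iff]

omit [DecidableEq α] in
/-- The rank-`q` sets, described by `toNat`. -/
theorem Rq_eq (M : Matroid α) [M.Finite] (q : ℕ) :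
    Profile.Rq M q = (gr M).powerset.filter (fun B : Finset α => (M.eRk (B : Set α)).toNat = q) := by
  ext B
  rw [Profile.mem_Rq, Finset.mem_filter, Finset.mem_powerset, toNat_eRk_eq_iff]

open scoped Classical in
/-- THE ROW `(r−2, r−1)` OF (Π) on every matroid with thin colines. -/
theorem profileIneq_of_thin (M : Matroid α) [M.Finite] (r : ℕ) (h2 : 2 ≤ r)
    (hthin : ∀ I ∈ (gr M).powerset, (M.eRk (I : Set α)).toNat = r - 2 →
      r - 1 ≤ (M.eRk ((gr M \ I : Finset α) : Set α)).toNat →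
      (M.eRk ((gr M \ I : Finset α) : Set α)).toNat ≤
        ((gr M).filter (fun d => d ∉ M.closure (I : Set α))).card) :
    Profile.ProfileIneq M (r - 2) (r - 1) := by
  unfold Profile.ProfileIneq
  have hsum : (∑ B ∈ Profile.Rq M (r - 2), Profile.price M (r - 2) (r - 1) B) =
      (1 / ((r - 1 : ℕ) : ℚ)) * ((∑ I ∈ (gr M).powerset, (if (M.eRk (I : Set α)).toNat = r - 2 ∧
        r - 1 ≤ (M.eRk ((gr M \ I : Finset α) : Set α)).toNat then
        (M.eRk ((gr M \ I : Finset α) : Set α)).toNat else 0) : ℕ) : ℚ) := by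
    rw [Rq_eq, Finset.sum_filter, Nat.cast_sum, Finset.mul_sum]
    apply Finset.sum_congr rfl
    intro I _
    rw [price_eq M r h2 I]
    by_cases ha : (M.eRk (I : Set α)).toNat = r - 2
    · by_cases hb : r - 1 ≤ (M.eRk ((gr M \ I : Finset α) : Set α)).toNat
      · rw [if_pos ha, if_pos hb, if_pos ⟨ha, hb⟩]; ring
      · rw [if_pos ha, if_neg hb, if_neg (fun h => hb h.2)]; simp
    · rw [if_neg ha, if_neg (fun h => ha h.1)]; simp
  have hlev : ((Shadow.levelSet M (r - 1)).card : ℚ) =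
      (((gr M).powerset.filter (fun S : Finset α => (M.eRk (S : Set α)).toNat = r - 1)).card : ℚ) := by
    rw [levelSet_eq]
  rw [hsum, hlev]
  have hr : (0 : ℚ) < ((r - 1 : ℕ) : ℚ) := by exact_mod_cast (by omega : 0 < r - 1)
  have hmain := sum_le_of_thin M r h2 hthin
  rw [one_div, inv_mul_le_iff₀ hr]
  exact_mod_cast hmain

open scoped Classical in
/-- C-025 AT `(r, r−2)` ON EVERY MATROID WITH THIN COLINES: `r·#{A : ρ(A) = r, ρ(E∖A) = r−2} ≤ (r−1)·#{A : ρ(A) = r−1}`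
(`ThmN.RLS M r (r−2)`, `phiK r (r−2) = r/(r−1)`), by the landed bridge from the single row `(r−2, r−1)`. -/
theorem rls_of_thin (M : Matroid α) [M.Finite] (r : ℕ) (h2 : 2 ≤ r)
    (hthin : ∀ I ∈ (gr M).powerset, (M.eRk (I : Set α)).toNat = r - 2 →
      r - 1 ≤ (M.eRk ((gr M \ I : Finset α) : Set α)).toNat →
      (M.eRk ((gr M \ I : Finset α) : Set α)).toNat ≤
        ((gr M).filter (fun d => d ∉ M.closure (I : Set α))).card) :
    ThmN.RLS M r (r - 2) := by
  apply GirthRows.rls_of_profileIneq_rows r (r - 2)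
  intro u hu1 hu2
  have : u = r - 1 := by omega
  subst this
  exact profileIneq_of_thin M r h2 hthin

open scoped Classical in
/-- THIN COLINES FROM THE FLATS: if every set of rank `r−2` has at least `r = ρ(E)` elements outside its closure,
the sources have enough directions. -/
theorem thin_of_flats (M : Matroid α) [M.Finite] (r : ℕ) (hr : M.eRank = (r : ℕ∞))
    (hflat : ∀ I ∈ (gr M).powerset, (M.eRk (I : Set α)).toNat = r - 2 →
      r ≤ ((gr M).filter (fun d => d ∉ M.closure (I : Set α))).card) :
    ∀ I ∈ (gr M).powerset, (M.eRk (I : Set α)).toNat = r - 2 →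
      r - 1 ≤ (M.eRk ((gr M \ I : Finset α) : Set α)).toNat →
      (M.eRk ((gr M \ I : Finset α) : Set α)).toNat ≤
        ((gr M).filter (fun d => d ∉ M.closure (I : Set α))).card := by
  intro I hI hIr _
  refine le_trans ?_ (hflat I hI hIr)
  have h := M.eRk_le_eRank ((gr M \ I : Finset α) : Set α)
  rw [hr] at h
  have := ENat.toNat_le_toNat h (by simp)
  simpa using this

open scoped Classical in
/-- THE INSTANCE `[r−2, r−2, 1; 2r−3]` when every rank-`(r−2)` set has at least `r` elements outside its closure. -/
theorem pld_instance_of_flats (M : Matroid α) [M.Finite] (r : ℕ) (h2 : 2 ≤ r) (hr : M.eRank = (r : ℕ∞))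
    (hflat : ∀ I ∈ (gr M).powerset, (M.eRk (I : Set α)).toNat = r - 2 →
      r ≤ ((gr M).filter (fun d => d ∉ M.closure (I : Set α))).card) :
    (∑ I ∈ (gr M).powerset, (if r - 2 ≤ (M.eRk (I : Set α)).toNat ∧ (M.eRk (I : Set α)).toNat ≤ r - 2 ∧
        2 * r - 3 ≤ (M.eRk ((gr M \ I : Finset α) : Set α)).toNat + (M.eRk (I : Set α)).toNat then
        ((M.eRk ((gr M \ I : Finset α) : Set α)).toNat).choose 1 else 0)) ≤
      ∑ I ∈ (gr M).powerset, (if r - 2 + 1 ≤ (M.eRk ((gr M \ I : Finset α) : Set α)).toNat ∧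
        (M.eRk ((gr M \ I : Finset α) : Set α)).toNat ≤ r - 2 + 1 then
        ((M.eRk ((gr M \ I : Finset α) : Set α)).toNat).choose 1 else 0) :=
  pld_instance_of_thin M r h2 (thin_of_flats M r hr hflat)

open scoped Classical in
/-- C-025 AT `(r, r−2)` when every rank-`(r−2)` set has at least `r` elements outside its closure. -/
theorem rls_of_thin_flats (M : Matroid α) [M.Finite] (r : ℕ) (h2 : 2 ≤ r) (hr : M.eRank = (r : ℕ∞))
    (hflat : ∀ I ∈ (gr M).powerset, (M.eRk (I : Set α)).toNat = r - 2 →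
      r ≤ ((gr M).filter (fun d => d ∉ M.closure (I : Set α))).card) :
    ThmN.RLS M r (r - 2) :=
  rls_of_thin M r h2 (thin_of_flats M r hr hflat)

end PLDThin

end PercRepro
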